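import Literature.MathematicalPhysics.QuantumFieldTheory.ConformalBootstrap3D.MeanFieldFormalExpansion
import Literature.MathematicalPhysics.QuantumFieldTheory.ConformalBootstrap3D.MixedBlockLeadingTrajectory
import Mathlib.Tactic
import HarnessLib

/-!
# The leading-twist edge of the mean-field block sums

In the Hogervorst–Rychkov frame the entry `(M, M)` (maximal spin at a given level, the coefficient of
`𝒫_{2p+M, M}`, i.e. of the monomial `z^{p+M} z̄^p`) of a formal block sum sees only the leading-twist blocks
`(2p+ℓ, ℓ)`, `ℓ ≤ M`, through their leading trajectory `A_{M-ℓ, M}(2p+ℓ, ℓ)` (`blockSum_edge`,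
`hrCoeffAB_leading_explicit`: Dolan–Osborn 2004 eq. (3.11), (3.13)). For the mean-field coefficients
`P_{0,ℓ}(p)/λ_ℓ = (p)_ℓ² / (ℓ! (2p+ℓ-1)_ℓ λ_ℓ)` (Fitzpatrick–Kaplan 2012 §2.2) the edge reduces to the
hypergeometric sums (`x = 2p - 1`)

  `Σ_{ℓ ≤ M} ε_ℓ C(M,ℓ) (x+2ℓ) / (x+ℓ)_{M+1}`,

which are evaluated here by telescoping: for `ε_ℓ = (-1)^ℓ` the sum is `δ_{M,0}` (Gosper antidifference
`z(ℓ) = -(-1)^ℓ ℓ C(M,ℓ)/(M (x+ℓ)_M)`, `leadingTwistSum_alt`), for `ε_ℓ = 1` it is `1/(p)_M` (Zeilberger recursion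
`(p+M) S(M+1) = S(M)` with certificate `G(M,ℓ) = -ℓ C(M+1,ℓ)(ℓ+p-1)/((M+1)(x+ℓ)_{M+1})`, `leadingTwistSum_one`).
These are the 1D (collinear) mean-field identities `z^p = Σ_ℓ (-1)^ℓ a_ℓ k_{2p+2ℓ}(z)`-type inversions in
coefficient form. Consequences: the edges of the two mean-field block sums,
`blockSum p ((-1)^ℓ P_{0,ℓ}/λ_ℓ, …) M M = δ_{M0}` (`blockSum_mft_alt_edge`) and
`blockSum p (P/λ) M M = (p)_M/(1/2)_M` (`blockSum_mft_edge`). Finite algebra throughout.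
[cite: FitzpatrickKaplan2012, §2.2] [cite: DolanOsborn2004, §3 eqs. (3.11), (3.13)]
-/

namespace Literature.MathematicalPhysics.QuantumFieldTheory.ConformalBootstrap3D

open Finset

/-! ### The two leading-twist hypergeometric sums -/

/-- The summand `t(M,ℓ) = C(M,ℓ) (x+2ℓ)/(x+ℓ)_{M+1}`, `x = 2p-1`. [folklore] -/
noncomputable def ltTerm (p : ℝ) (M ℓ : ℕ) : ℝ :=
  (M.choose ℓ : ℝ) * (2 * p - 1 + 2 * ℓ) / poch (2 * p - 1 + ℓ) (M + 1)

/-- Gosper antidifference for the alternating sum: `z(ℓ) = -(-1)^ℓ ℓ C(M,ℓ)/(M (x+ℓ)_M)`. [folklore] -/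
noncomputable def ltAnti (p : ℝ) (M ℓ : ℕ) : ℝ :=
  -((-1 : ℝ) ^ ℓ * ℓ * (M.choose ℓ : ℝ)) / (M * poch (2 * p - 1 + ℓ) M)

/-- The telescoping step `(-1)^ℓ t(M,ℓ) = z(ℓ+1) - z(ℓ)` (`M ≥ 1`, `p > 1/2`). [folklore] -/
theorem ltTerm_alt_eq_sub {p : ℝ} (hp : 1 / 2 < p) {M : ℕ} (hM : 1 ≤ M) (ℓ : ℕ) :
    (-1 : ℝ) ^ ℓ * ltTerm p M ℓ = ltAnti p M (ℓ + 1) - ltAnti p M ℓ := by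
  unfold ltTerm ltAnti
  have hx : 0 < 2 * p - 1 + ℓ := by have : (0:ℝ) ≤ ℓ := Nat.cast_nonneg ℓ; linarith
  -- Pochhammer relations: `(x+ℓ)_{M+1} = (x+ℓ)_M (x+ℓ+M) = (x+ℓ) (x+ℓ+1)_M`
  have e1 : poch (2 * p - 1 + ℓ) (M + 1) = poch (2 * p - 1 + ℓ) M * (2 * p - 1 + ℓ + M) := poch_succ _ _
  have e2 : poch (2 * p - 1 + ↑(ℓ + 1)) M * (2 * p - 1 + ℓ) = poch (2 * p - 1 + ℓ) (M + 1) := by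
    rw [poch_succ_left]; push_cast; ring_nf
  -- binomial relation `C(M,ℓ+1)(ℓ+1) = C(M,ℓ)(M-ℓ)` (as reals, valid for all `ℓ`)
  have hc : ((M.choose (ℓ + 1) : ℕ) : ℝ) * ((ℓ : ℝ) + 1) = (M.choose ℓ : ℝ) * ((M : ℝ) - ℓ) := by
    rcases le_or_gt ℓ M with hle | hlt
    · have h := Nat.choose_succ_right_eq M ℓ
      have h' : ((M.choose (ℓ + 1) * (ℓ + 1) : ℕ) : ℝ) = ((M.choose ℓ * (M - ℓ) : ℕ) : ℝ) := by rw [h]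
      push_cast [Nat.cast_sub hle] at h'
      linarith [h']
    · rw [Nat.choose_eq_zero_of_lt hlt, Nat.choose_eq_zero_of_lt (by omega)]; simp
  have hP1 : poch (2 * p - 1 + ℓ) (M + 1) ≠ 0 := poch_ne_zero hx (M + 1)
  have hM' : (M : ℝ) ≠ 0 := Nat.cast_ne_zero.mpr (by omega)
  have hxl : (2 * p - 1 + (ℓ : ℝ)) ≠ 0 := hx.ne'
  have hxlM : (2 * p - 1 + (ℓ : ℝ) + M) ≠ 0 := by
    have : (0 : ℝ) ≤ M := Nat.cast_nonneg M
    intro h; linarith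
  have hl1 : ((ℓ : ℝ) + 1) ≠ 0 := by positivity
  -- express everything over `(x+ℓ)_{M+1}` and through `C(M,ℓ)`
  rw [show poch (2 * p - 1 + ↑(ℓ + 1)) M = poch (2 * p - 1 + ℓ) (M + 1) / (2 * p - 1 + ℓ) by
      rw [eq_div_iff hxl, e2],
    show poch (2 * p - 1 + ℓ) M = poch (2 * p - 1 + ℓ) (M + 1) / (2 * p - 1 + ℓ + M) by
      rw [e1, mul_div_assoc, div_self hxlM, mul_one],
    show ((M.choose (ℓ + 1) : ℕ) : ℝ) = (M.choose ℓ : ℝ) * ((M : ℝ) - ℓ) / ((ℓ : ℝ) + 1) by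
      rw [eq_div_iff hl1, hc]]
  push_cast
  field_simp
  ring

/-- **Leading-twist sum, alternating**: `Σ_{ℓ ≤ M} (-1)^ℓ C(M,ℓ)(x+2ℓ)/(x+ℓ)_{M+1} = δ_{M,0}` (`x = 2p-1`,
`p > 1/2`). [folklore] -/
theorem leadingTwistSum_alt {p : ℝ} (hp : 1 / 2 < p) (M : ℕ) :
    ∑ ℓ ∈ range (M + 1), (-1 : ℝ) ^ ℓ * ltTerm p M ℓ = if M = 0 then 1 else 0 := by
  rcases Nat.eq_zero_or_pos M with h0 | hpos
  · subst h0
    have hx : (2 * p - 1) ≠ 0 := by intro h; linarith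
    simp [ltTerm, poch_one, hx]
  · rw [if_neg (by omega)]
    calc ∑ ℓ ∈ range (M + 1), (-1 : ℝ) ^ ℓ * ltTerm p M ℓ
        = ∑ ℓ ∈ range (M + 1), (ltAnti p M (ℓ + 1) - ltAnti p M ℓ) :=
          sum_congr rfl fun ℓ _ => ltTerm_alt_eq_sub hp hpos ℓ
      _ = ltAnti p M (M + 1) - ltAnti p M 0 := sum_range_sub _ _
      _ = 0 := by simp [ltAnti, Nat.choose_succ_self]

/-- Zeilberger certificate for the non-alternating sum: `G(M,ℓ) = -ℓ C(M+1,ℓ)(ℓ+p-1)/((M+1)(x+ℓ)_{M+1})`. [folklore] -/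
noncomputable def ltCert (p : ℝ) (M ℓ : ℕ) : ℝ :=
  -((ℓ : ℝ) * ((M + 1).choose ℓ : ℝ) * (ℓ + p - 1)) / (((M : ℝ) + 1) * poch (2 * p - 1 + ℓ) (M + 1))

/-- The Zeilberger step `(p+M) t(M+1,ℓ) - t(M,ℓ) = G(M,ℓ+1) - G(M,ℓ)` for `ℓ ≤ M` (`p > 1/2`). [folklore] -/
theorem ltTerm_zeil_step {p : ℝ} (hp : 1 / 2 < p) {M ℓ : ℕ} (hℓ : ℓ ≤ M) :
    (p + M) * ltTerm p (M + 1) ℓ - ltTerm p M ℓ = ltCert p M (ℓ + 1) - ltCert p M ℓ := by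
  unfold ltTerm ltCert
  have hl0 : (0 : ℝ) ≤ ℓ := Nat.cast_nonneg ℓ
  have hx : 0 < 2 * p - 1 + ℓ := by linarith
  set P := poch (2 * p - 1 + ℓ) (M + 1) with hPdef
  have hP : P ≠ 0 := poch_ne_zero hx (M + 1)
  -- Pochhammer relations
  have e1 : poch (2 * p - 1 + ℓ) (M + 1 + 1) = P * (2 * p + ℓ + M) := by
    rw [hPdef, poch_succ]; push_cast; ring
  have e2 : poch (2 * p - 1 + ↑(ℓ + 1)) (M + 1) = P * (2 * p + ℓ + M) / (2 * p - 1 + ℓ) := by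
    rw [eq_div_iff hx.ne', hPdef]
    have := poch_succ_left (2 * p - 1 + ℓ) (M + 1)
    rw [poch_succ] at this
    push_cast at this ⊢
    rw [show 2 * p - 1 + ((ℓ : ℝ) + 1) = 2 * p - 1 + ℓ + 1 by ring]
    linear_combination (-1 : ℝ) * this
  -- binomial relations (as reals): `C(M+1,ℓ)(M+1-ℓ) = C(M,ℓ)(M+1)`, `C(M+1,ℓ+1)(ℓ+1) = (M+1) C(M,ℓ)`
  have hb : (((M + 1).choose ℓ : ℕ) : ℝ) * ((M : ℝ) + 1 - ℓ) = (M.choose ℓ : ℝ) * ((M : ℝ) + 1) := by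
    have h := Nat.choose_mul_succ_eq M ℓ
    have h' : ((M.choose ℓ * (M + 1) : ℕ) : ℝ) = (((M + 1).choose ℓ * (M + 1 - ℓ) : ℕ) : ℝ) := by rw [h]
    push_cast [Nat.cast_sub (show ℓ ≤ M + 1 by omega)] at h'
    linarith [h']
  have ha : (((M + 1).choose (ℓ + 1) : ℕ) : ℝ) * ((ℓ : ℝ) + 1) = ((M : ℝ) + 1) * (M.choose ℓ : ℝ) := by
    have h := Nat.add_one_mul_choose_eq M ℓ
    have h' : (((M + 1) * M.choose ℓ : ℕ) : ℝ) = (((M + 1).choose (ℓ + 1) * (ℓ + 1) : ℕ) : ℝ) := by rw [h]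
    push_cast at h'
    linarith [h']
  have hMl : ((M : ℝ) + 1 - ℓ) ≠ 0 := by
    have : (ℓ : ℝ) ≤ M := by exact_mod_cast hℓ
    linarith
  have hM1 : ((M : ℝ) + 1) ≠ 0 := by positivity
  have hl1 : ((ℓ : ℝ) + 1) ≠ 0 := by positivity
  have hxM : (2 * p + (ℓ : ℝ) + M) ≠ 0 := by
    have : (0 : ℝ) ≤ M := Nat.cast_nonneg M
    intro h; linarith
  rw [show (((M + 1).choose ℓ : ℕ) : ℝ) = (M.choose ℓ : ℝ) * ((M : ℝ) + 1) / ((M : ℝ) + 1 - ℓ) by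
      rw [eq_div_iff hMl, hb],
    show (((M + 1).choose (ℓ + 1) : ℕ) : ℝ) = ((M : ℝ) + 1) * (M.choose ℓ : ℝ) / ((ℓ : ℝ) + 1) by
      rw [eq_div_iff hl1, ha], e1, e2]
  push_cast
  field_simp
  ring

/-- **Leading-twist sum, non-alternating**: `Σ_{ℓ ≤ M} C(M,ℓ)(x+2ℓ)/(x+ℓ)_{M+1} = 1/(p)_M` (`x = 2p-1`,
`p > 1/2`). [folklore] -/
theorem leadingTwistSum_one {p : ℝ} (hp : 1 / 2 < p) (M : ℕ) :
    ∑ ℓ ∈ range (M + 1), ltTerm p M ℓ = 1 / poch p M := by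
  induction M with
  | zero =>
    have hx : (2 * p - 1) ≠ 0 := by intro h; linarith
    simp [ltTerm, poch_one, hx]
  | succ M ih =>
    -- `(p+M) S(M+1) = S(M)`: telescoping over `ℓ ≤ M` plus the last term `ℓ = M+1`
    have hsum : (p + M) * ∑ ℓ ∈ range (M + 1 + 1), ltTerm p (M + 1) ℓ = ∑ ℓ ∈ range (M + 1), ltTerm p M ℓ := by
      rw [sum_range_succ, mul_add, mul_sum]
      have htel : ∑ ℓ ∈ range (M + 1), (p + M) * ltTerm p (M + 1) ℓ =
          ∑ ℓ ∈ range (M + 1), ltTerm p M ℓ + (ltCert p M (M + 1) - ltCert p M 0) := by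
        rw [← sum_range_sub (ltCert p M), ← sum_add_distrib]
        refine sum_congr rfl fun ℓ hℓ => ?_
        rw [mem_range] at hℓ
        linarith [ltTerm_zeil_step hp (show ℓ ≤ M by omega)]
      rw [htel]
      -- `G(M,0) = 0`, and `(p+M) t(M+1,M+1) + G(M,M+1) = 0`
      have h0 : ltCert p M 0 = 0 := by simp [ltCert]
      have hM0 : (0 : ℝ) ≤ M := Nat.cast_nonneg M
      have hlast : (p + M) * ltTerm p (M + 1) (M + 1) + ltCert p M (M + 1) = 0 := by
        unfold ltTerm ltCert
        rw [Nat.choose_self, poch_succ]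
        have hM1 : ((M : ℝ) + 1) ≠ 0 := by positivity
        push_cast
        rw [show (2 : ℝ) * p - 1 + ((M : ℝ) + 1) = 2 * p + M by ring]
        have hP : poch (2 * p + M) (M + 1) ≠ 0 := poch_ne_zero (by linarith) _
        have hq : (2 * p + (M : ℝ) + ((M : ℝ) + 1)) ≠ 0 := by intro h; linarith
        field_simp
        ring
      rw [h0]
      linarith [hlast]
    have hpM : (p + M) ≠ 0 := by have : (0:ℝ) ≤ M := Nat.cast_nonneg M; intro h; linarith
    have hpp : poch p M ≠ 0 := poch_ne_zero (by linarith) M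
    rw [poch_succ]
    have : ∑ ℓ ∈ range (M + 1 + 1), ltTerm p (M + 1) ℓ = (∑ ℓ ∈ range (M + 1), ltTerm p M ℓ) / (p + M) := by
      rw [eq_div_iff hpM, mul_comm, hsum]
    rw [this, ih]
    field_simp

/-! ### The edge of the mean-field block sums -/

/-- The leading trajectory of the leading-twist block `(2p+ℓ, ℓ)` in Pochhammer form:
`A_{N,ℓ+N}(2p+ℓ, ℓ) = (p+ℓ)_N² (ℓ+1)_N / ((ℓ+1/2)_N N! (2p+2ℓ)_N)` (Dolan–Osborn 2004 eq. (3.11), (3.13) at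
`λ₁ = p + ℓ`, `a = b = 0`). [cite: DolanOsborn2004, §3 eqs. (3.11), (3.13)] -/
theorem hrCoeff_leading_twist (p : ℝ) (ℓ N : ℕ) :
    hrCoeff (2 * p + ℓ) ℓ N (ℓ + N) =
      poch (p + ℓ) N ^ 2 * poch ((ℓ : ℝ) + 1) N /
        (poch ((ℓ : ℝ) + 1 / 2) N * (N.factorial : ℝ) * poch (2 * p + 2 * ℓ) N) := by
  rw [← hrCoeffAB_zero_zero, hrCoeffAB_leading_explicit]
  induction N with
  | zero => simp
  | succ N ih =>
    rw [prod_range_succ, ih, poch_succ, poch_succ, poch_succ, poch_succ, Nat.factorial_succ]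
    have hl : (0 : ℝ) ≤ ℓ := Nat.cast_nonneg ℓ
    have hN : (0 : ℝ) ≤ N := Nat.cast_nonneg N
    have h1 : poch ((ℓ : ℝ) + 1 / 2) N ≠ 0 := poch_ne_zero (by linarith) N
    have h2 : (N.factorial : ℝ) ≠ 0 := by positivity
    have h4 : (2 * (ℓ : ℝ) + 2 * N + 1) ≠ 0 := by positivity
    have h5 : (2 * ((N : ℝ) + 1)) ≠ 0 := by positivity
    -- `(2p+2ℓ)_N` and `2p+ℓ+ℓ+N` may vanish for non-positive `p`; treat by cases to stay unconditional
    by_cases h3 : poch (2 * p + 2 * ℓ) N = 0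
    · simp [h3]
    by_cases h6 : (2 * p + ℓ + ℓ + N) = 0
    · have : (2 * p + 2 * ℓ + N) = 0 := by linarith
      simp [this, h6]
    have h6' : (2 * p + 2 * ℓ + N) ≠ 0 := by intro h; apply h6; linarith
    push_cast
    field_simp
    ring

/-- **The edge summand of a mean-field block sum, reduced**: for `ℓ ≤ M`,
`(P_{0,ℓ}(p)/λ_ℓ) · A_{M-ℓ,M}(2p+ℓ,ℓ) = (p)_M²/(1/2)_M · C(M,ℓ)(x+2ℓ)/(x+ℓ)_{M+1}` (`x = 2p-1`, `p > 1/2`).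
[cite: FitzpatrickKaplan2012, §2.2] -/
theorem mft_edge_term {p : ℝ} (hp : 1 / 2 < p) {M ℓ : ℕ} (hℓ : ℓ ≤ M) :
    mftCoeff p 0 ℓ / legendreLam ℓ * hrCoeff (2 * p + ℓ) ℓ (M - ℓ) M =
      poch p M ^ 2 / poch (1 / 2) M * ltTerm p M ℓ := by
  obtain ⟨N, rfl⟩ : ∃ N, M = ℓ + N := ⟨M - ℓ, by omega⟩
  rw [Nat.add_sub_cancel_left, hrCoeff_leading_twist, mftCoeff_zero_left, legendreLam_eq_poch]
  unfold ltTerm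
  -- Pochhammer bookkeeping
  have ePM : poch p (ℓ + N) = poch p ℓ * poch (p + ℓ) N := poch_add p ℓ N
  have eH : poch (1 / 2) (ℓ + N) = poch (1 / 2) ℓ * poch ((ℓ : ℝ) + 1 / 2) N := by
    rw [poch_add]; ring_nf
  have eF : poch ((ℓ : ℝ) + 1) N * (ℓ.factorial : ℝ) = ((ℓ + N).factorial : ℝ) := poch_succ_nat_mul_factorial ℓ N
  have eX : poch (2 * p - 1 + ℓ) (ℓ + N + 1) =
      poch (2 * p + ℓ - 1) ℓ * (2 * p - 1 + 2 * ℓ) * poch (2 * p + 2 * ℓ) N := by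
    rw [show ℓ + N + 1 = ℓ + (N + 1) by ring, poch_add, poch_succ_left]
    ring_nf
  have eC : ((ℓ + N).choose ℓ : ℝ) * ((ℓ.factorial : ℝ) * (N.factorial : ℝ)) = ((ℓ + N).factorial : ℝ) := by
    have h := Nat.choose_mul_factorial_mul_factorial (show ℓ ≤ ℓ + N by omega)
    rw [Nat.add_sub_cancel_left] at h
    exact_mod_cast (by rw [← mul_assoc]; exact h)
  -- positivity of everything in sight
  have hl0 : (0 : ℝ) ≤ ℓ := Nat.cast_nonneg ℓ
  have f1 : (ℓ.factorial : ℝ) ≠ 0 := by positivity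
  have f2 : (N.factorial : ℝ) ≠ 0 := by positivity
  have f3 : ((ℓ + N).factorial : ℝ) ≠ 0 := by positivity
  have q1 : poch (1 / 2) ℓ ≠ 0 := poch_ne_zero (by norm_num) ℓ
  have q2 : poch ((ℓ : ℝ) + 1 / 2) N ≠ 0 := poch_ne_zero (by linarith) N
  have q3 : poch (2 * p + ℓ - 1) ℓ ≠ 0 := poch_ne_zero (by linarith) ℓ
  have q4 : poch (2 * p + 2 * ℓ) N ≠ 0 := poch_ne_zero (by linarith) N
  have q5 : (2 * p - 1 + 2 * (ℓ : ℝ)) ≠ 0 := by intro h; linarith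
  have q6 : poch p ℓ ≠ 0 := poch_ne_zero (by linarith) ℓ
  have q7 : poch (p + ℓ) N ≠ 0 := poch_ne_zero (by linarith) N
  have q8 : poch ((ℓ : ℝ) + 1) N ≠ 0 := poch_ne_zero (by linarith) N
  rw [ePM, eH, eX]
  rw [show poch ((ℓ : ℝ) + 1) N = ((ℓ + N).factorial : ℝ) / (ℓ.factorial : ℝ) by rw [eq_div_iff f1, eF],
    show (((ℓ + N).choose ℓ : ℕ) : ℝ) = ((ℓ + N).factorial : ℝ) / ((ℓ.factorial : ℝ) * (N.factorial : ℝ)) by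
      rw [eq_div_iff (mul_ne_zero f1 f2), eC]]
  field_simp

/-- **The edge of a mean-field block sum**: for any sign pattern `ε`,
`blockSum p (ε_ℓ P_{n,ℓ}(p)/λ_ℓ) M M = (p)_M²/(1/2)_M · Σ_{ℓ ≤ M} ε_ℓ t(M,ℓ)`. [cite: FitzpatrickKaplan2012, §2.2] -/
theorem blockSum_mft_edge_sum {p : ℝ} (hp : 1 / 2 < p) (ε : ℕ → ℝ) (M : ℕ) :
    blockSum p (fun n ℓ => ε ℓ * mftCoeff p n ℓ / legendreLam ℓ) M M =
      poch p M ^ 2 / poch (1 / 2) M * ∑ ℓ ∈ range (M + 1), ε ℓ * ltTerm p M ℓ := by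
  rw [blockSum_edge, mul_sum]
  refine sum_congr rfl fun ℓ hℓ => ?_
  rw [mem_range] at hℓ
  have h := mft_edge_term hp (show ℓ ≤ M by omega)
  calc ε ℓ * mftCoeff p 0 ℓ / legendreLam ℓ * hrCoeff (2 * p + ℓ) ℓ (M - ℓ) M
      = ε ℓ * (mftCoeff p 0 ℓ / legendreLam ℓ * hrCoeff (2 * p + ℓ) ℓ (M - ℓ) M) := by ring
    _ = poch p M ^ 2 / poch (1 / 2) M * (ε ℓ * ltTerm p M ℓ) := by rw [h]; ring

/-- **Edge of the alternating mean-field block sum** (`u^p` family): `= δ_{M,0}`. [cite: FitzpatrickKaplan2012, §2.2] -/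
theorem blockSum_mft_alt_edge {p : ℝ} (hp : 1 / 2 < p) (M : ℕ) :
    blockSum p (fun n ℓ => (-1 : ℝ) ^ ℓ * mftCoeff p n ℓ / legendreLam ℓ) M M = if M = 0 then 1 else 0 := by
  rw [blockSum_mft_edge_sum hp, leadingTwistSum_alt hp]
  split_ifs with h
  · subst h; simp
  · simp

/-- **Edge of the mean-field block sum** (`(u/v)^p` family): `= (p)_M/(1/2)_M`. [cite: FitzpatrickKaplan2012, §2.2] -/
theorem blockSum_mft_edge {p : ℝ} (hp : 1 / 2 < p) (M : ℕ) :
    blockSum p (fun n ℓ => (1 : ℝ) * mftCoeff p n ℓ / legendreLam ℓ) M M = poch p M / poch (1 / 2) M := by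
  rw [blockSum_mft_edge_sum hp]
  simp only [one_mul]
  rw [leadingTwistSum_one hp]
  have h1 : poch p M ≠ 0 := poch_ne_zero (by linarith) M
  have h2 : poch (1 / 2) M ≠ 0 := poch_ne_zero (by norm_num) M
  field_simp

end Literature.MathematicalPhysics.QuantumFieldTheory.ConformalBootstrap3D
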